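import Summits.Ventures.PackingBounds.Energy.FivePointRieszSixDefs
import HarnessLib

/-!
# `FivePointRieszSix`: the value of the bound `5(4c - F(1,1,1) - a₁) = 505/288`

Framing: lottery ticket; floor = certified bounds/negative ranges. Venture `PackingBounds`, cell
`pub-packcert`, energy family E3PT (pub-packcert-energy gen 15; n = 3, d = 8 kernel route = KERNEL-D6 double data route, size-split).
-/

noncomputable section

namespace Summit.Ventures.PackingBounds.Energy.FivePointRieszSix

set_option maxRecDepth 20000 in
set_option maxHeartbeats 400000000 in
/-- The value of the bound: `5(4c - F(1,1,1) - a₁) = 505/288` (the Riesz `6`-energy of the triangular bipyramid over ordered pairs). -/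
theorem bound_eqR6 : (5 : ℝ) * ((5 - 1) * c0KR6 - FexpKR6 1 1 1 - a1KR6 * 1) = ((505 : ℝ)/288) := by
  unfold c0KR6 FexpKR6 FexpK_c0R6 FexpK_c1R6 FexpK_c2R6 FexpK_c3R6 FexpK_c4R6 FexpK_c5R6 a1KR6; ring

end Summit.Ventures.PackingBounds.Energy.FivePointRieszSix
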